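import Literature.Probability.RandomPlanarGeometry.SAWCountZdSymbolDegree
import HarnessLib

/-!
# The TOP shape classes of the symbol polynomial `R_j`: on `2j` letters every axis occurs twice and the zero block is `x y x̄ ȳ`

Topic `Literature/Probability/RandomPlanarGeometry` (the «SYMBOL POLYNOMIALITY» programme, car λ «LEADING SHAPE COEFFICIENT», part 1 of 4; on top of
`SAWCountZdSymbolDegree.lean` (a-p1 g23: `four_le_of_zero_block`, `breaks_add_three_le_of_mem_shapeClass`, η `natDegree_symbolPoly_le_sub_three`)).

PRINTED CONTEXT (locators only; nothing is quoted digit-for-digit). Madras–Slade (1993) §1.1 eq. (1.1.8) p. 5 (the `1/d` expansion of `μ` after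
Fisher–Sykes / Fisher–Gaunt, "although there is no rigorous control of their error term"), Definition 1.2.4, §1.2 p. 10; Clisby–Liang–Slade (2007) §3.3
eqs. (29)/(31) (enumerations decomposed by the number of dimensions explored). NOT IN PRINT as far as the lane's desks could locate (lit-1 g30 / lit-2 g31,
2026-08-27; FINDING-ZD-SYMBOL-POLYNOMIALITY §6(b)): the statements below (lane theorems about the lane's own symbol polynomial `R_j = symbolPoly j` of
`SAWCountZdSymbolPolynomiality.lean`, a-p1 g22, and its shape classes `shapeClass j u A` of `SAWCountZdRepeatSetShapes.lean`).

THE STRUCTURE THEOREM (this file). The `X^{2j−3}` coefficient of `R_j` only sees the shape classes `shapeClass j (2j) A` with `breaks A = 2j − 3`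
(part 4). HERE: for `κ ∈ shapeClass j (2j) A` every axis occurs EXACTLY twice (`card_axCls_eq_two`: `j` axes, `2j` letters, every position repeated);
a class with `m − 3` breaks on `m` letters has its three adjacencies CONSECUTIVE — `A = topVec m p` (`exists_eq_topVec_of_mem_shapeClass`, from the run-wise
zero block of length `≥ 4`); and for `A = topVec m p` the zero block is exactly `[p, p+4)` (`bsumW_top_eq_zero`) and reads `x y x̄ ȳ`: the letters at
`p + 2`, `p + 3` are the reversals of those at `p`, `p + 1`, on two distinct axes (`top_block`, via `exists_opp_in_block` and `not_three_axCls`).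
Tool notions (the lane's, not in print): `topVec m p` (adjacencies at `p, p+1, p+2`), `axCls κ q` (the positions on the axis of `q`).

THIS FILE (lane «pcv-sawmu», a-p1 g25; all PROVED, standard axioms): `topVec`, `topVec_eq_true_iff`, `axCls`, `mem_axCls`, `self_mem_axCls`,
`axCls_eq_of_mem`, ★ `card_axCls_eq_two`, `exists_axCls_eq_pair`, `not_three_axCls`, ★ `bsumW_top_eq_zero`, `exists_opp_in_block`, ★★ `top_block`,
`adjValid_topVec`, `breaks_topVec`, `topVec_injOn`, ★ `exists_eq_topVec_of_mem_shapeClass`.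
[cite: MadrasSlade1993, §1.1 eq. (1.1.8) p. 5; Definition 1.2.4; §1.2 (p. 10)] [cite: ClisbyLiangSlade2007, §3.3 eqs. (29)/(31)]

Provenance: lane «pcv-sawmu», a-p1 g25 (2026-08-28).
-/

open Finset
open scoped BigOperators
open Literature.Probability.LatticeModels
open Literature.Probability.RandomPlanarGeometry.SAW
open Literature.Probability.Percolation

namespace Literature.Probability.RandomPlanarGeometry.SAW.Zd

namespace WordTypes

variable {m : ℕ}

/-- The TOP adjacency vector with its three adjacencies at `p, p+1, p+2` (one run of four letters starting at `p`, every other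
position a run of its own). [cite: MadrasSlade1993, Definition 1.2.4; lane tool notion] -/
def topVec (m p : ℕ) : Fin m → Bool := fun k => decide (p ≤ k.val ∧ k.val ≤ p + 2)

/-- `topVec m p k = true ↔ p ≤ k ≤ p + 2`. [cite: MadrasSlade1993, Definition 1.2.4; lane plumbing] -/
theorem topVec_eq_true_iff {m p : ℕ} (k : Fin m) : topVec m p k = true ↔ p ≤ k.val ∧ k.val ≤ p + 2 := by
  simp [topVec]

open Classical in
/-- The axis class of position `q` in `κ`: the positions carrying the axis of `q`. [cite: MadrasSlade1993, Definition 1.2.4; lane tool notion] -/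
def axCls (κ : Word m m) (q : Fin m) : Finset (Fin m) := Finset.univ.filter fun q' => (κ q').1 = (κ q).1

/-- `q' ∈ axCls κ q ↔` same axis. [cite: MadrasSlade1993, Definition 1.2.4; lane plumbing] -/
theorem mem_axCls {κ : Word m m} {q q' : Fin m} : q' ∈ axCls κ q ↔ (κ q').1 = (κ q).1 := by
  classical
  simp [axCls]

/-- `q ∈ axCls κ q`. [cite: MadrasSlade1993, Definition 1.2.4; lane plumbing] -/
theorem self_mem_axCls (κ : Word m m) (q : Fin m) : q ∈ axCls κ q := mem_axCls.2 rfl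

/-- Axis classes are equal or disjoint: `q' ∈ axCls κ q → axCls κ q' = axCls κ q`. [cite: MadrasSlade1993, Definition 1.2.4; lane plumbing] -/
theorem axCls_eq_of_mem {κ : Word m m} {q q' : Fin m} (h : q' ∈ axCls κ q) : axCls κ q' = axCls κ q := by
  ext x
  rw [mem_axCls, mem_axCls, mem_axCls.1 h]

open Classical in
/-- ★ IN A TOP SHAPE CLASS EVERY AXIS OCCURS EXACTLY TWICE: `κ ∈ shapeClass j (2j) A ⇒ #axCls κ q = 2` for every position `q`
(`j` axes on `2j` letters, every position repeated). [cite: MadrasSlade1993, Definition 1.2.4; lane lemma] -/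
theorem card_axCls_eq_two {j : ℕ} (hm : m = 2 * j) {A : Fin m → Bool} {κ : Word m m} (hκ : κ ∈ shapeClass j m A)
    (q : Fin m) : (axCls κ q).card = 2 := by
  unfold shapeClass at hκ
  simp only [Finset.mem_filter, Finset.mem_univ, true_and] at hκ
  obtain ⟨-, hax, hrep, -, -⟩ := hκ
  have hI : (Finset.univ.image fun q : Fin m => (κ q).1).card = j := by rw [← numAxes_eq_card_image]; omega
  have hge : ∀ x ∈ Finset.univ.image (fun q : Fin m => (κ q).1),
      2 ≤ (Finset.univ.filter fun q' : Fin m => (κ q').1 = x).card := by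
    intro x hx
    obtain ⟨q0, -, rfl⟩ := Finset.mem_image.1 hx
    obtain ⟨q1, hq1, h1⟩ := hrep q0
    have hsub : ({q0, q1} : Finset (Fin m)) ⊆ Finset.univ.filter fun q' => (κ q').1 = (κ q0).1 := by
      intro x hx
      rw [Finset.mem_insert, Finset.mem_singleton] at hx
      rw [Finset.mem_filter]
      rcases hx with rfl | rfl
      · exact ⟨Finset.mem_univ _, rfl⟩
      · exact ⟨Finset.mem_univ _, h1⟩
    have := Finset.card_le_card hsub
    rwa [Finset.card_pair hq1.symm] at this
  have hsum := Finset.card_eq_sum_card_image (fun q : Fin m => (κ q).1) Finset.univ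
  rw [Finset.card_univ, Fintype.card_fin] at hsum
  by_contra hne
  have h2 := hge (κ q).1 (Finset.mem_image_of_mem _ (Finset.mem_univ q))
  have h3 : 3 ≤ (Finset.univ.filter fun q' : Fin m => (κ q').1 = (κ q).1).card := by
    unfold axCls at hne; omega
  have hlt : ∑ x ∈ Finset.univ.image (fun q : Fin m => (κ q).1), 2 <
      ∑ x ∈ Finset.univ.image (fun q : Fin m => (κ q).1), (Finset.univ.filter fun q' : Fin m => (κ q').1 = x).card :=
    Finset.sum_lt_sum hge ⟨(κ q).1, Finset.mem_image_of_mem _ (Finset.mem_univ q), h3⟩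
  rw [Finset.sum_const, smul_eq_mul, hI] at hlt
  omega

/-- In a top shape class the axis class of `q` is `{q, q'}` for a unique PARTNER `q' ≠ q`. [cite: MadrasSlade1993, Definition 1.2.4; lane lemma] -/
theorem exists_axCls_eq_pair {j : ℕ} (hm : m = 2 * j) {A : Fin m → Bool} {κ : Word m m} (hκ : κ ∈ shapeClass j m A)
    (q : Fin m) : ∃ q' : Fin m, q' ≠ q ∧ axCls κ q = {q, q'} := by
  classical
  have h2 := card_axCls_eq_two hm hκ q
  obtain ⟨a, b, hab, hcls⟩ := Finset.card_eq_two.1 h2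
  have hq : q ∈ ({a, b} : Finset (Fin m)) := hcls ▸ self_mem_axCls κ q
  rw [Finset.mem_insert, Finset.mem_singleton] at hq
  rcases hq with rfl | rfl
  · exact ⟨b, hab.symm, hcls⟩
  · exact ⟨a, hab, by rw [hcls, Finset.pair_comm]⟩

/-- Three positions never share an axis in a top shape class. [cite: MadrasSlade1993, Definition 1.2.4; lane plumbing] -/
theorem not_three_axCls {j : ℕ} (hm : m = 2 * j) {A : Fin m → Bool} {κ : Word m m} (hκ : κ ∈ shapeClass j m A)
    {a b c : Fin m} (hab : a ≠ b) (hac : a ≠ c) (hbc : b ≠ c) (hb : (κ b).1 = (κ a).1) (hc : (κ c).1 = (κ a).1) : False := by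
  classical
  have h2 := card_axCls_eq_two hm hκ a
  have hsub : ({a, b, c} : Finset (Fin m)) ⊆ axCls κ a := by
    intro x hx
    simp only [Finset.mem_insert, Finset.mem_singleton] at hx
    rcases hx with rfl | rfl | rfl
    · exact self_mem_axCls κ x
    · exact mem_axCls.2 hb
    · exact mem_axCls.2 hc
  have := Finset.card_le_card hsub
  rw [Finset.card_insert_of_notMem (by simp [hab, hac]), Finset.card_pair hbc] at this
  omega

/-- ★ THE ZERO BLOCK OF A TOP SHAPE CLASS IS `[p, p+4)`: for `κ ∈ shapeClass j m (topVec m p)`, `p + 4 ≤ m` and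
`bsumW κ p (p + 4) = 0`. [cite: MadrasSlade1993, Definition 1.2.4; lane lemma] -/
theorem bsumW_top_eq_zero {j p : ℕ} {κ : Word m m} (hκ : κ ∈ shapeClass j m (topVec m p)) :
    p + 4 ≤ m ∧ bsumW κ p (p + 4) = 0 := by
  unfold shapeClass at hκ
  simp only [Finset.mem_filter, Finset.mem_univ, true_and] at hκ
  obtain ⟨-, -, -, hnr, i, i', hii', hi', hA, hpos⟩ := hκ
  have h4 := four_le_of_zero_block _ κ hnr hii' hi' hA hpos
  have h1 := hA ⟨i, by omega⟩ le_rfl (by simp only; omega)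
  have h2 := hA ⟨i' - 2, by omega⟩ (by simp only; omega) (by simp only; omega)
  rw [topVec_eq_true_iff] at h1 h2
  simp only at h1 h2
  have hi : i = p := by omega
  have hi4 : i' = p + 4 := by omega
  subst hi hi4
  exact ⟨hi', (wordPos_eq_iff_bsumW κ (by omega) hi').1 hpos⟩

open Classical in
/-- In a top shape class every letter of the block `[p, p+4)` has its OPPOSITE (same axis, flipped sign) inside the block.
[cite: MadrasSlade1993, Definition 1.2.4; lane lemma] -/
theorem exists_opp_in_block {j p : ℕ} {κ : Word m m} (hκ : κ ∈ shapeClass j m (topVec m p))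
    (q : Fin m) (hq : p ≤ q.val ∧ q.val < p + 4) :
    ∃ q' : Fin m, (p ≤ q'.val ∧ q'.val < p + 4) ∧ q' ≠ q ∧ κ q' = ((κ q).1, !(κ q).2) := by
  obtain ⟨-, hz⟩ := bsumW_top_eq_zero hκ
  unfold bsumW at hz
  rw [sum_twoStepV_eq_zero_iff] at hz
  have hx := hz (κ q).1
  have hqt : q ∈ Finset.univ.filter (fun r : Fin m => p ≤ r.val ∧ r.val < p + 4) := Finset.mem_filter.2 ⟨Finset.mem_univ _, hq⟩
  have hne : ((Finset.univ.filter (fun r : Fin m => p ≤ r.val ∧ r.val < p + 4)).filter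
      fun r => κ r = ((κ q).1, !(κ q).2)).Nonempty := by
    rw [← Finset.card_pos]
    cases hs : (κ q).2
    · have hmem : q ∈ (Finset.univ.filter (fun r : Fin m => p ≤ r.val ∧ r.val < p + 4)).filter
          fun r => κ r = ((κ q).1, false) := Finset.mem_filter.2 ⟨hqt, Prod.ext rfl hs⟩
      have hpos := Finset.card_pos.2 ⟨q, hmem⟩
      simp only [Bool.not_false]
      omega
    · have hmem : q ∈ (Finset.univ.filter (fun r : Fin m => p ≤ r.val ∧ r.val < p + 4)).filter
          fun r => κ r = ((κ q).1, true) := Finset.mem_filter.2 ⟨hqt, Prod.ext rfl hs⟩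
      have hpos := Finset.card_pos.2 ⟨q, hmem⟩
      simp only [Bool.not_true]
      omega
  obtain ⟨q', hq'⟩ := hne
  rw [Finset.mem_filter] at hq'
  refine ⟨q', (Finset.mem_filter.1 hq'.1).2, ?_, hq'.2⟩
  rintro rfl
  have := congrArg Prod.snd hq'.2
  cases h : (κ q').2 <;> simp [h] at this

/-- ★ THE BLOCK OF A TOP SHAPE CLASS IS `x y x̄ ȳ`: for `κ ∈ shapeClass j (2j) (topVec p)` the letters at `p + 2`, `p + 3` are the opposites
of those at `p`, `p + 1`, and the two block axes differ. [cite: MadrasSlade1993, Definition 1.2.4; lane lemma] -/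
theorem top_block {j p : ℕ} (hm : m = 2 * j) {κ : Word m m} (hκ : κ ∈ shapeClass j m (topVec m p)) (hp4 : p + 4 ≤ m) :
    κ ⟨p + 2, by omega⟩ = ((κ ⟨p, by omega⟩).1, !(κ ⟨p, by omega⟩).2) ∧
      κ ⟨p + 3, by omega⟩ = ((κ ⟨p + 1, by omega⟩).1, !(κ ⟨p + 1, by omega⟩).2) ∧
        (κ ⟨p, by omega⟩).1 ≠ (κ ⟨p + 1, by omega⟩).1 := by
  have hnr : RunNoRev (topVec m p) κ := by
    unfold shapeClass at hκ
    simp only [Finset.mem_filter, Finset.mem_univ, true_and] at hκ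
    exact hκ.2.2.2.1
  have nr : ∀ i (hi : i + 1 < m), p ≤ i → i ≤ p + 2 →
      κ ⟨i + 1, hi⟩ ≠ ((κ ⟨i, by omega⟩).1, !(κ ⟨i, by omega⟩).2) :=
    fun i hi h1 h2 => hnr ⟨i, by omega⟩ hi ((topVec_eq_true_iff _).2 ⟨h1, h2⟩)
  -- the opposite of the letter at `p` sits at `q ∈ {p+2, p+3}`; of the letter at `p+1` at `r ∈ {p, p+3}`
  obtain ⟨q, hqt, hqne, hq⟩ := exists_opp_in_block hκ ⟨p, by omega⟩ ⟨le_rfl, by simp only; omega⟩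
  obtain ⟨r, hrt, hrne, hr⟩ := exists_opp_in_block hκ ⟨p + 1, by omega⟩ ⟨by simp only; omega, by simp only; omega⟩
  have hqv : q.val ≠ p := fun h => hqne (Fin.ext h)
  have hrv : r.val ≠ p + 1 := fun h => hrne (Fin.ext h)
  have hq1 : q.val ≠ p + 1 := by
    intro h
    have hq' : q = ⟨p + 1, by omega⟩ := Fin.ext h
    exact nr p (by omega) le_rfl (by omega) (by rw [← hq']; exact hq)
  have hr2 : r.val ≠ p + 2 := by
    intro h
    have hr' : r = ⟨p + 2, by omega⟩ := Fin.ext h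
    exact nr (p + 1) (by omega) (by omega) (by omega) (by rw [← hr']; exact hr)
  have hqax : (κ q).1 = (κ ⟨p, by omega⟩).1 := by rw [hq]
  have hrax : (κ r).1 = (κ ⟨p + 1, by omega⟩).1 := by rw [hr]
  -- `r ≠ p`: else `p`, `p+1`, `q` share an axis
  have hrp : r.val ≠ p := by
    intro h
    have hr' : r = ⟨p, by omega⟩ := Fin.ext h
    rw [hr'] at hrax
    -- axes of p and p+1 agree; q is a third position on that axis
    exact not_three_axCls hm hκ (a := ⟨p, by omega⟩) (b := ⟨p + 1, by omega⟩) (c := q)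
      (by simp [Fin.ext_iff]) (fun h => hqv (by rw [← h])) (fun h => hq1 (by rw [← h])) hrax.symm hqax
  have hr3 : r = ⟨p + 3, by omega⟩ := Fin.ext (by simp only; omega)
  -- `q ≠ p+3`: else `p`, `p+1`, `p+3` share an axis
  have hq3 : q.val ≠ p + 3 := by
    intro h
    have hq' : q = ⟨p + 3, by omega⟩ := Fin.ext h
    rw [hq'] at hqax
    rw [hr3] at hrax
    exact not_three_axCls hm hκ (a := ⟨p, by omega⟩) (b := ⟨p + 1, by omega⟩) (c := ⟨p + 3, by omega⟩)
      (by simp [Fin.ext_iff]) (by simp [Fin.ext_iff]) (by simp [Fin.ext_iff]) (by rw [← hrax, hqax]) hqax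
  have hq2 : q = ⟨p + 2, by omega⟩ := Fin.ext (by simp only; omega)
  rw [hq2] at hq hqax
  rw [hr3] at hr
  refine ⟨hq, hr, fun hax => ?_⟩
  exact not_three_axCls hm hκ (a := ⟨p, by omega⟩) (b := ⟨p + 1, by omega⟩) (c := ⟨p + 2, by omega⟩)
    (by simp [Fin.ext_iff]) (by simp [Fin.ext_iff]) (by simp [Fin.ext_iff]) hax.symm hqax

/-! ### Which adjacency vectors carry a top class: exactly the `topVec m p`, `p + 4 ≤ m` -/

/-- `topVec m p` is a valid adjacency vector when `p + 4 ≤ m` (its last entry is a break). [cite: MadrasSlade1993, Definition 1.2.4; lane plumbing] -/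
theorem adjValid_topVec {m p : ℕ} (hp : p + 4 ≤ m) : AdjValid (topVec m p) := by
  intro h
  rw [Bool.eq_false_iff, Ne, topVec_eq_true_iff]
  simp only
  omega

open Classical in
/-- `topVec m p` has exactly three adjacencies, hence `m − 3` breaks (`p + 4 ≤ m`). [cite: MadrasSlade1993, Definition 1.2.4; lane plumbing] -/
theorem breaks_topVec {m p : ℕ} (hp : p + 4 ≤ m) : breaks (topVec m p) = m - 3 := by
  unfold breaks
  have htrue : (Finset.univ.filter fun k : Fin m => topVec m p k = true) = {⟨p, by omega⟩, ⟨p + 1, by omega⟩, ⟨p + 2, by omega⟩} := by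
    ext k
    rw [Finset.mem_filter, topVec_eq_true_iff]
    simp only [Finset.mem_univ, true_and, Finset.mem_insert, Finset.mem_singleton, Fin.ext_iff]
    omega
  have h3 : (Finset.univ.filter fun k : Fin m => topVec m p k = true).card = 3 := by
    rw [htrue, Finset.card_insert_of_notMem (by simp [Fin.ext_iff]), Finset.card_pair (by simp [Fin.ext_iff])]
  have hsum := Finset.card_filter_add_card_filter_not (s := (Finset.univ : Finset (Fin m))) (fun k : Fin m => topVec m p k = true)
  simp only [Finset.card_univ, Fintype.card_fin, Bool.not_eq_true] at hsum
  omega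

/-- `p ↦ topVec m p` is injective on `p + 4 ≤ m`. [cite: MadrasSlade1993, Definition 1.2.4; lane plumbing] -/
theorem topVec_injOn {m p p' : ℕ} (hp : p + 4 ≤ m) (hp' : p' + 4 ≤ m) (h : topVec m p = topVec m p') : p = p' := by
  have h1 : topVec m p' ⟨p, by omega⟩ = true := by rw [← h, topVec_eq_true_iff]; simp
  have h2 : topVec m p ⟨p', by omega⟩ = true := by rw [h, topVec_eq_true_iff]; simp
  rw [topVec_eq_true_iff] at h1 h2
  simp only at h1 h2
  omega

open Classical in
/-- ★ A NON-EMPTY class on `m` letters with `m − 3` breaks has its adjacency vector equal to some `topVec m p`, `p + 4 ≤ m`: the three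
adjacencies are forced to be consecutive by the run-wise zero block of length `≥ 4` (`four_le_of_zero_block`).
[cite: MadrasSlade1993, Definition 1.2.4; lane lemma] -/
theorem exists_eq_topVec_of_mem_shapeClass {j : ℕ} {A : Fin m → Bool} (hb : breaks A + 3 = m) {κ : Word m m}
    (hκ : κ ∈ shapeClass j m A) : ∃ p : ℕ, p + 4 ≤ m ∧ A = topVec m p := by
  unfold shapeClass at hκ
  simp only [Finset.mem_filter, Finset.mem_univ, true_and] at hκ
  obtain ⟨-, -, -, hnr, i, i', hii', hi', hA, hpos⟩ := hκ
  have h4 := four_le_of_zero_block A κ hnr hii' hi' hA hpos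
  refine ⟨i, by omega, ?_⟩
  -- the true set of `A` has three elements and contains `i, i+1, i+2`
  have hsub : ({⟨i, by omega⟩, ⟨i + 1, by omega⟩, ⟨i + 2, by omega⟩} : Finset (Fin m)) ⊆
      Finset.univ.filter fun k : Fin m => A k = true := by
    intro k hk
    simp only [Finset.mem_insert, Finset.mem_singleton] at hk
    rw [Finset.mem_filter]
    refine ⟨Finset.mem_univ _, ?_⟩
    rcases hk with rfl | rfl | rfl
    · exact hA _ le_rfl (by simp only; omega)
    · exact hA _ (by simp only; omega) (by simp only; omega)
    · exact hA _ (by simp only; omega) (by simp only; omega)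
  have hsum := Finset.card_filter_add_card_filter_not (s := (Finset.univ : Finset (Fin m))) (fun k : Fin m => A k = false)
  simp only [Finset.card_univ, Fintype.card_fin, Bool.not_eq_false] at hsum
  have h3 : (Finset.univ.filter fun k : Fin m => A k = true).card = 3 := by unfold breaks at hb; omega
  have hcard3 : ({⟨i, by omega⟩, ⟨i + 1, by omega⟩, ⟨i + 2, by omega⟩} : Finset (Fin m)).card = 3 := by
    rw [Finset.card_insert_of_notMem (by simp [Fin.ext_iff]), Finset.card_pair (by simp [Fin.ext_iff])]
  have heq := Finset.eq_of_subset_of_card_le hsub (by rw [h3, hcard3])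
  funext k
  rw [Bool.eq_iff_iff, topVec_eq_true_iff]
  constructor
  · intro hk
    have hmem : k ∈ Finset.univ.filter fun k : Fin m => A k = true := Finset.mem_filter.2 ⟨Finset.mem_univ _, hk⟩
    rw [← heq] at hmem
    simp only [Finset.mem_insert, Finset.mem_singleton, Fin.ext_iff] at hmem
    omega
  · intro hk
    have hmem : k ∈ ({⟨i, by omega⟩, ⟨i + 1, by omega⟩, ⟨i + 2, by omega⟩} : Finset (Fin m)) := by
      simp only [Finset.mem_insert, Finset.mem_singleton, Fin.ext_iff]; omega
    rw [heq, Finset.mem_filter] at hmem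
    exact hmem.2


end WordTypes

end Literature.Probability.RandomPlanarGeometry.SAW.Zd
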